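import Summits.Ventures.PercRepro.RankLevelSetExplicitArithB
import Summits.Ventures.PercRepro.RankLevelSetFrameLarge
import Summits.Ventures.PercRepro.RankLevelSetCoreGeneral
import Summits.Ventures.PercRepro.RankLevelSetLocalSparse
import Summits.Ventures.PercRepro.RankLevelSetDepCountGen
import Summits.Ventures.PercRepro.RankLevelSetCircuitCount
import Summits.Ventures.PercRepro.RankLevelSetLevelFiveArithA
import Summits.Ventures.PercRepro.RankLevelSetFrameQM
import Summits.Ventures.PercRepro.RankLevelSetPlaneSix
import Summits.Ventures.PercRepro.RankLevelSetTheoremCFull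

/-!
# PercRepro — THE CELL MAP OF THE `e`-FREE CORE AT EVERY LEVEL (p9, sub-claim S4 of the crux `C025`;
`proofs/SUBCLAIM-S4-p9.md` §S4.3″)

Night-1's cell maps (dossier §15.12 / §15.13, levels 4 … 6) at EVERY level `q ≥ 3`, with explicit thresholds: the
`e`-free core of rank `p` and corank `d` satisfies C-025 at level `q` when
* `d ≥ q + 2^q + 1` and `p ≥ N₁(q) = 2^{q+1} + 2q² + 4q + 4` (`c025_core_explicit_large'`; `p ≥ 386` at `q = 7`), or
* `q + 1 ≤ d ≤ q + 2^q` and `p ≥ Tcell q (d − q − 1)`, `Tcell q m = q²·2^{⌊(qm+3q+10)/2⌋+1} + 16q·2^q + 3·2^q + 2q + 5`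
  (`c025_core_explicit_cell`; single-exponential in `q` at every fixed `m`: `Tcell 7 0 ≈ 3.2·10^6`, `Tcell 7 1 ≈ 5.1·10^7`,
  … — the fibre `σ(d) = Σ_{j ≤ m} C(2^q − q − 2, j) ≤ (2^q − q − 1)^m ≤ 2^{qm}` replaces the saturated `2^{2^q − q − 2}`).
`c025_core_cell_map` is the disjunction. Inside the window `q + 2 ≤ p < PexpS q` of THEOREM P′ the OPEN cells of level
`q` are therefore the `(p, d)` with `q + 1 ≤ d ≤ q + 2^q`, `p < Tcell q (d − q − 1)` — and the cells `d ≥ q + 2^q + 1`,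
`p < N₁(q)`. Axioms: standard.
-/

open scoped Matroid

namespace PercRepro

namespace ThmN

namespace Explicit

/-- `Σ_{j ≤ t} C(F, j) ≤ (F + 1)^t`. -/
theorem sum_range_choose_le_succ_pow (F : ℕ) : ∀ t, ∑ j ∈ Finset.range (t + 1), F.choose j ≤ (F + 1) ^ t := by
  intro t
  induction t with
  | zero => simp
  | succ t ih =>
    rw [Finset.sum_range_succ]
    have h1 : F.choose (t + 1) ≤ F ^ (t + 1) := Nat.choose_le_pow _ _
    have h2 : F ^ t ≤ (F + 1) ^ t := Nat.pow_le_pow_left (by omega) t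
    calc ∑ j ∈ Finset.range (t + 1), F.choose j + F.choose (t + 1) ≤ (F + 1) ^ t + F ^ (t + 1) :=
          Nat.add_le_add ih h1
      _ ≤ (F + 1) ^ t + (F + 1) ^ t * F := by
          apply Nat.add_le_add_left
          calc F ^ (t + 1) = F ^ t * F := by ring
            _ ≤ (F + 1) ^ t * F := Nat.mul_le_mul_right _ h2
      _ = (F + 1) ^ (t + 1) := by ring

/-- The per-corank threshold `Tcell q m` for corank `d = q + 1 + m`:
`q²·2^{⌊(qm+3q+10)/2⌋+1} + 16q·2^q + 3·2^q + 2q + 5` — single-exponential in `q` at every fixed `m`. -/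
def Tcell (q m : ℕ) : ℕ :=
  q ^ 2 * 2 ^ ((q * m + 3 * q + 10) / 2 + 1) + 16 * q * 2 ^ q + 3 * 2 ^ q + 2 * q + 5

/-- `(q²·2^{⌊x/2⌋+1})² ≥ q⁴·2^{x+1}`. -/
theorem sq_two_pow_half (q x : ℕ) : q ^ 4 * 2 ^ (x + 1) ≤ (q ^ 2 * 2 ^ (x / 2 + 1)) ^ 2 := by
  have h : x + 1 ≤ (x / 2 + 1) * 2 := by omega
  calc q ^ 4 * 2 ^ (x + 1) ≤ q ^ 4 * 2 ^ ((x / 2 + 1) * 2) :=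
        Nat.mul_le_mul_left _ (Nat.pow_le_pow_right (by norm_num) h)
    _ = (q ^ 2 * 2 ^ (x / 2 + 1)) ^ 2 := by rw [mul_pow, ← pow_mul]; ring

/-- **(A5-cell)** the polynomial inequality at ONE corank `d = q + 1 + m` with the fibre `σ ≤ 2^{qm}`:
`8·(C(p+d, q) + N) ≤ 7·2^{d−q}·C(p+q, q)` for `p ≥ Tcell q m` whenever
`N ≤ σ·(q−1)·2^{d+q}·C(p+d, q−2)`, `σ ≤ 2^{q·m}`. -/
theorem poly_main_cell (q m p N σ : ℕ) (hq : 3 ≤ q) (hp : Tcell q m ≤ p) (hσ : σ ≤ 2 ^ (q * m))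
    (hN : N ≤ σ * (q - 1) * 2 ^ (2 * q + 1 + m) * (p + q + 1 + m).choose (q - 2)) :
    8 * ((p + q + 1 + m).choose q + N) ≤ 7 * 2 ^ (m + 1) * (p + q).choose q := by
  obtain ⟨q', rfl⟩ : ∃ q', q = q' + 2 := ⟨q - 2, by omega⟩
  have e1 : q' + 2 - 1 = q' + 1 := by omega
  have e2 : q' + 2 - 2 = q' := by omega
  rw [e1, e2] at hN
  unfold Tcell at hp
  set x := (q' + 2) * m + 3 * (q' + 2) + 10 with hx
  have hfirst : (q' + 2) ^ 2 * 2 ^ (x / 2 + 1) ≤ p + 1 := by omega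
  have h16m : 8 * (2 * (q' + 2) * (m + 1)) ≤ p + 1 := by
    have hm : m + 1 ≤ 2 ^ m := succ_le_two_pow m
    have hexp : m + 4 ≤ x / 2 + 1 := by
      have : 2 * m + 6 ≤ x := by rw [hx]; nlinarith
      omega
    calc 8 * (2 * (q' + 2) * (m + 1)) = 16 * (q' + 2) * (m + 1) := by ring
      _ ≤ 16 * (q' + 2) * 2 ^ m := Nat.mul_le_mul_left _ hm
      _ = (q' + 2) * 2 ^ (m + 4) := by ring
      _ ≤ (q' + 2) ^ 2 * 2 ^ (x / 2 + 1) :=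
          Nat.mul_le_mul (by nlinarith) (Nat.pow_le_pow_right (by norm_num) hexp)
      _ ≤ p + 1 := hfirst
  obtain ⟨h2, h3⟩ := ratio_bounds (q' + 2) m p h16m
  have h5 := choose_two_down (p + (q' + 2) + 1 + m) q' p (by omega)
  have hsq : σ * 2 ^ (3 * (q' + 2) + 10) * (q' + 2) ^ 4 ≤ (p + 1) ^ 2 := by
    have hT2 := Nat.pow_le_pow_left hfirst 2
    have hsq' := sq_two_pow_half (q' + 2) x
    calc σ * 2 ^ (3 * (q' + 2) + 10) * (q' + 2) ^ 4
        ≤ 2 ^ ((q' + 2) * m) * 2 ^ (3 * (q' + 2) + 10) * (q' + 2) ^ 4 := by gcongr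
      _ = (q' + 2) ^ 4 * 2 ^ x := by rw [← pow_add, hx]; ring
      _ ≤ (q' + 2) ^ 4 * 2 ^ (x + 1) := Nat.mul_le_mul_left _ (Nat.pow_le_pow_right (by norm_num) (by omega))
      _ ≤ ((q' + 2) ^ 2 * 2 ^ (x / 2 + 1)) ^ 2 := hsq'
      _ ≤ (p + 1) ^ 2 := hT2
  have h6 := N_term_bound q' m p N σ _ _ _ hN h5 h3 hsq
  have h7 : 9 + 5 * 2 ^ m ≤ 7 * 2 ^ (m + 1) := by
    have : 1 ≤ 2 ^ m := Nat.one_le_two_pow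
    rw [pow_succ]; omega
  calc 8 * ((p + (q' + 2) + 1 + m).choose (q' + 2) + N)
      = 8 * (p + (q' + 2) + 1 + m).choose (q' + 2) + 8 * N := by ring
    _ ≤ 9 * (p + (q' + 2)).choose (q' + 2) + 5 * 2 ^ m * (p + (q' + 2)).choose (q' + 2) :=
        Nat.add_le_add h2 h6
    _ = (9 + 5 * 2 ^ m) * (p + (q' + 2)).choose (q' + 2) := by ring
    _ ≤ 7 * 2 ^ (m + 1) * (p + (q' + 2)).choose (q' + 2) := Nat.mul_le_mul_right _ h7

end Explicit

open Set

variable {α : Type}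

/-- **THE CELL MAP AT EVERY LEVEL**: the `e`-free core at level `q ≥ 3`, ONE corank `d = q + 1 + m ≤ q + 2^q`, rank
`p ≥ Tcell q m` (single-exponential in `q` at fixed `m`: `Tcell 7 0 = 49·2^{16} + …`). The proof of
`c025_core_explicit_bounded` with the fibre bound `σ(d) ≤ (2^q − q − 1)^m ≤ 2^{qm}` in place of `2^{2^q−q−2}`. -/
theorem c025_core_explicit_cell (q : ℕ) (hq : 3 ≤ q) (M : Matroid α) [M.Finite] (p d : ℕ)
    (hp : Explicit.Tcell q (d - (q + 1)) ≤ p) (hd1 : q + 1 ≤ d) (hd2 : d ≤ q + 2 ^ q)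
    (hR : M.eRank = (p : ℕ∞)) (hn : M.E.ncard = p + d)
    (hfree : ∀ e ∈ M.E, ∃ A ⊆ M.E \ {e}, e ∉ M.closure A ∧ e ∉ M.closure ((M.E \ {e}) \ A)) :
    RLS M p q := by
  classical
  obtain ⟨m, rfl⟩ : ∃ m, d = q + 1 + m := ⟨d - (q + 1), by omega⟩
  rw [show q + 1 + m - (q + 1) = m by omega] at hp
  have hq1 := Explicit.succ_le_two_pow q
  have hp16 : 16 * q * 2 ^ q + 3 * 2 ^ q + 2 * q + 5 ≤ p := by
    unfold Explicit.Tcell at hp; omega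
  have hEcard : M.ground_finite.toFinset.card = p + (q + 1 + m) := by
    rw [← Set.ncard_eq_toFinset_card _ M.ground_finite]; exact hn
  have hL : ∀ e ∈ M.E, ¬ M.IsLoop e := not_isLoop_of_free M hfree
  have hs : ∀ e ∈ M.E, ∀ f ∈ M.E, e ≠ f → M.eRk {e, f} = 2 := by
    intro e he f hf hef
    have h2 : (2 : ℕ∞) ≤ M.eRk {e, f} :=
      two_le_eRk_of_two_le_ncard_of_free M hfree (pair_subset he hf) (by rw [ncard_pair hef])
    have h3 : M.eRk {e, f} ≤ 2 := by
      have := M.eRk_le_encard {e, f}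
      rwa [encard_pair hef] at this
    exact le_antisymm h3 h2
  have hcirc : ∀ C, M.IsCircuit C → 3 ≤ C.encard := three_le_encard_of_circuit M hL hs
  have hflat : ∀ X ⊆ M.E, M.eRk X ≤ q → X.ncard ≤ 2 ^ q - 1 := by
    intro X hX hr
    have := ncard_add_one_le_two_pow_of_eRk_le M hL hfree q X hX hr
    omega
  have hd : M.E.encard = M.eRank + ((q + 1 + m : ℕ) : ℕ∞) := by
    rw [hR, ← M.ground_finite.cast_ncard_eq, hn]
    push_cast
    ring
  have hU1 := Matroid.topCount_le_ncard_compl (M := M) hR hd q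
  have hU2 := Matroid.ncard_eRk_eq_ncard_le_le M q (2 ^ q - 1) hcirc hflat (q + 1 + m)
  rw [hn] at hU2
  -- `σ ≤ (2^q − q − 1)^m ≤ 2^{qm}`
  have hσ : ∑ j ∈ Finset.range (q + 1 + m - (q + 1) + 1), Nat.choose (2 ^ q - 1 - (q + 1)) j ≤
      2 ^ (q * m) := by
    rw [show q + 1 + m - (q + 1) = m by omega]
    calc ∑ j ∈ Finset.range (m + 1), Nat.choose (2 ^ q - 1 - (q + 1)) j
        ≤ (2 ^ q - 1 - (q + 1) + 1) ^ m := Explicit.sum_range_choose_le_succ_pow _ m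
      _ ≤ (2 ^ q) ^ m := Nat.pow_le_pow_left (by omega) m
      _ = 2 ^ (q * m) := by rw [← pow_mul]
  have hhalf : q - 2 ≤ (p + (q + 1 + m)) / 2 := by omega
  have hsum : ∑ k ∈ Finset.Icc 3 (q + 1),
      {C | M.IsCircuit C ∧ C.ncard = k}.ncard * (p + (q + 1 + m)).choose (q + 1 - k) ≤
        (q - 1) * (2 ^ (2 * q + 1 + m) * (p + (q + 1 + m)).choose (q - 2)) := by
    calc ∑ k ∈ Finset.Icc 3 (q + 1),
          {C | M.IsCircuit C ∧ C.ncard = k}.ncard * (p + (q + 1 + m)).choose (q + 1 - k)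
        ≤ ∑ _k ∈ Finset.Icc 3 (q + 1), 2 ^ (2 * q + 1 + m) * (p + (q + 1 + m)).choose (q - 2) := by
          apply Finset.sum_le_sum
          intro k hk
          rw [Finset.mem_Icc] at hk
          have hc : {C | M.IsCircuit C ∧ C.ncard = k}.ncard ≤ (q + 1 + m + (k - 1)).choose k := by
            have := Matroid.ncard_circuits_le_choose_of_encard M hd (k - 1)
            rw [show k - 1 + 1 = k by omega] at this
            exact this
          have hc2 : (q + 1 + m + (k - 1)).choose k ≤ 2 ^ (2 * q + 1 + m) :=
            (Nat.choose_le_two_pow _ _).trans (Nat.pow_le_pow_right (by norm_num) (by omega))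
          have hmono : (p + (q + 1 + m)).choose (q + 1 - k) ≤ (p + (q + 1 + m)).choose (q - 2) :=
            Explicit.choose_le_choose_of_le_half _ _ _ (by omega) hhalf
          exact Nat.mul_le_mul (hc.trans hc2) hmono
      _ = (q - 1) * (2 ^ (2 * q + 1 + m) * (p + (q + 1 + m)).choose (q - 2)) := by
          rw [Finset.sum_const, Nat.card_Icc, smul_eq_mul]
          congr 1
  set σ : ℕ := ∑ j ∈ Finset.range (q + 1 + m - (q + 1) + 1), Nat.choose (2 ^ q - 1 - (q + 1)) j with hσdef
  set N : ℕ := σ * ∑ k ∈ Finset.Icc 3 (q + 1),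
      {C | M.IsCircuit C ∧ C.ncard = k}.ncard * (p + (q + 1 + m)).choose (q + 1 - k) with hNdef
  have hN : N ≤ σ * (q - 1) * 2 ^ (2 * q + 1 + m) * (p + q + 1 + m).choose (q - 2) := by
    rw [show p + q + 1 + m = p + (q + 1 + m) by ring]
    calc N ≤ σ * ((q - 1) * (2 ^ (2 * q + 1 + m) * (p + (q + 1 + m)).choose (q - 2))) :=
          Nat.mul_le_mul_left _ hsum
      _ = _ := by ring
  have hU : Matroid.topCount M p q ≤ (p + (q + 1 + m)).choose q + N := hU1.trans hU2
  have hY := Matroid.two_pow_le_midCount_add (M := M) p q hR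
  have hA : {X : Set α | X ⊆ M.E ∧ M.eRk X ≤ q}.ncard ≤
      ∑ j ∈ Finset.range (2 ^ q - 1 + 1), (p + (q + 1 + m)).choose j := by
    calc {X : Set α | X ⊆ M.E ∧ M.eRk X ≤ q}.ncard
        ≤ {X : Set α | X ⊆ (M.ground_finite.toFinset : Set α) ∧ X.ncard ≤ 2 ^ q - 1}.ncard := by
          apply ncard_le_ncard
          · intro X hX
            exact ⟨by rw [Set.Finite.coe_toFinset]; exact hX.1, hflat X hX.1 hX.2⟩
          · exact (Finset.finite_toSet _).finite_subsets.subset (fun X hX => hX.1)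
      _ ≤ ∑ j ∈ Finset.range (2 ^ q - 1 + 1), M.ground_finite.toFinset.card.choose j :=
          ncard_subsets_ncard_le _ (2 ^ q - 1)
      _ = ∑ j ∈ Finset.range (2 ^ q - 1 + 1), (p + (q + 1 + m)).choose j := by rw [hEcard]
  have hB := Matroid.ncard_spanning_le (M := M) hd
  rw [hEcard] at hY hB
  have hT : 16 * ∑ j ∈ Finset.range (q + 2 ^ q + 1), (p + (q + 1 + m)).choose j ≤ 2 ^ (p + (q + 1 + m)) :=
    Explicit.sixteen_mul_sum_range_choose_le (q + 2 ^ q) (p + (q + 1 + m)) (by omega)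
  have hA' : ∑ j ∈ Finset.range (2 ^ q - 1 + 1), (p + (q + 1 + m)).choose j ≤
      ∑ j ∈ Finset.range (q + 2 ^ q + 1), (p + (q + 1 + m)).choose j :=
    Finset.sum_le_sum_of_subset_of_nonneg (Finset.range_mono (by omega)) (fun _ _ _ => Nat.zero_le _)
  have hB' : ∑ j ∈ Finset.range (q + 1 + m + 1), (p + (q + 1 + m)).choose j ≤
      ∑ j ∈ Finset.range (q + 2 ^ q + 1), (p + (q + 1 + m)).choose j :=
    Finset.sum_le_sum_of_subset_of_nonneg (Finset.range_mono (by omega)) (fun _ _ _ => Nat.zero_le _)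
  have hAB : 8 * ({X : Set α | X ⊆ M.E ∧ M.eRk X ≤ q}.ncard +
      {X : Set α | X ⊆ M.E ∧ M.eRk X = M.eRank}.ncard) ≤ 2 ^ (p + (q + 1 + m)) := by
    have h1 := hA.trans hA'
    have h2 := hB.trans hB'
    omega
  have hΦ := phiK_le_two_pow_div p q
  rw [Nat.choose_symm_add] at hΦ
  have hpoly := Explicit.poly_main_cell q m p N σ hq hp hσ hN
  rw [show p + q + 1 + m = p + (q + 1 + m) by ring] at hpoly
  rw [RLS_iff]
  have hUq : (Matroid.topCount M p q : ℚ) ≤ ((p + (q + 1 + m)).choose q : ℚ) + (N : ℚ) := by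
    exact_mod_cast hU
  have hYq : (2 : ℚ) ^ (p + (q + 1 + m)) ≤ (Matroid.midCount M p q : ℚ) +
      ({X : Set α | X ⊆ M.E ∧ M.eRk X ≤ q}.ncard : ℚ) +
      ({X : Set α | X ⊆ M.E ∧ M.eRk X = M.eRank}.ncard : ℚ) := by exact_mod_cast hY
  have hABq : 8 * (({X : Set α | X ⊆ M.E ∧ M.eRk X ≤ q}.ncard : ℚ) +
      ({X : Set α | X ⊆ M.E ∧ M.eRk X = M.eRank}.ncard : ℚ)) ≤ 2 ^ (p + (q + 1 + m)) := by
    exact_mod_cast hAB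
  have hpolyq : 8 * (((p + (q + 1 + m)).choose q : ℚ) + (N : ℚ)) ≤
      7 * 2 ^ (q + 1 + m - q) * ((p + q).choose q : ℚ) := by
    rw [show q + 1 + m - q = m + 1 by omega]
    exact_mod_cast hpoly
  have hU0 : (0 : ℚ) ≤ (Matroid.topCount M p q : ℚ) := Nat.cast_nonneg _
  exact level_arith (p := p) (d := q + 1 + m) (n := p + (q + 1 + m)) (q := q) rfl (by omega) hΦ hU0 hUq hYq
    hABq hpolyq


/-- **The large-corank core with its own threshold**: corank `≥ q + 2^q + 1` and `p ≥ N₁(q) = 2^{q+1} + 2q² + 4q + 4`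
(`q ≥ 3`) — single-exponential, e.g. `p ≥ 386` at `q = 7`. -/
theorem c025_core_explicit_large' (q : ℕ) (hq : 3 ≤ q) (M : Matroid α) [M.Finite] (p : ℕ)
    (hp : 2 ^ (q + 1) + 2 * q ^ 2 + 4 * q + 4 ≤ p) (hR : M.eRank = (p : ℕ∞)) (hbig : p + q + 2 ^ q < M.E.ncard)
    (hfree : ∀ e ∈ M.E, ∃ A ⊆ M.E \ {e}, e ∉ M.closure A ∧ e ∉ M.closure ((M.E \ {e}) \ A)) :
    RLS M p q := by
  have hq1 := Explicit.succ_le_two_pow q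
  refine core_all_corank_of_thresholds_of_bound q (2 ^ q - 1) (by omega) (by omega)
    (2 ^ (q + 1) + 2 * q ^ 2 + 4 * q + 4) (2 ^ (q + 1) + 3 * q + 2) (fun n hn => Explicit.regime_one q n hn)
    (fun p' hp' => Explicit.regime_two q (by omega) p' hp') M p ?_ hR ?_ hfree ?_
  · have h1 : 2 ^ (q + 1) + 3 * q + 2 ≤ 2 ^ (q + 1) + 2 * q ^ 2 + 4 * q + 4 := by nlinarith
    have h2 : 2 ^ q + 2 ≤ 2 ^ (q + 1) + 2 * q ^ 2 + 4 * q + 4 := by rw [pow_succ]; nlinarith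
    exact max_le (max_le hp (h1.trans hp)) (h2.trans hp)
  · omega
  · intro j hj X hX hr
    have hL := not_isLoop_of_free M hfree
    have h1 := ncard_add_one_le_two_pow_of_eRk_le M hL hfree j X hX hr
    have h2 := Explicit.two_pow_add_le_two_pow_add j q hj
    omega

/-- **THE CELL MAP OF THE `e`-FREE CORE AT EVERY LEVEL `q ≥ 3`**: a cell `(p, d)` (rank `p`, corank `d`, `e`-free) is
closed when `d ≥ q + 2^q + 1` and `p ≥ N₁(q)`, or when `q + 1 ≤ d ≤ q + 2^q` and `p ≥ Tcell q (d − q − 1)`. -/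
theorem c025_core_cell_map (q : ℕ) (hq : 3 ≤ q) (M : Matroid α) [M.Finite] (p d : ℕ)
    (hR : M.eRank = (p : ℕ∞)) (hn : M.E.ncard = p + d)
    (hfree : ∀ e ∈ M.E, ∃ A ⊆ M.E \ {e}, e ∉ M.closure A ∧ e ∉ M.closure ((M.E \ {e}) \ A))
    (hcell : (q + 2 ^ q + 1 ≤ d ∧ 2 ^ (q + 1) + 2 * q ^ 2 + 4 * q + 4 ≤ p) ∨
      (q + 1 ≤ d ∧ d ≤ q + 2 ^ q ∧ Explicit.Tcell q (d - (q + 1)) ≤ p)) :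
    RLS M p q := by
  rcases hcell with ⟨hd, hp⟩ | ⟨hd1, hd2, hp⟩
  · exact c025_core_explicit_large' q hq M p hp hR (by omega) hfree
  · exact c025_core_explicit_cell q hq M p d hp hd1 hd2 hR hn hfree

end ThmN

end PercRepro
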